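import Mathlib
import Literature.MathematicalPhysics.StatisticalMechanics.HaggStacking
import Literature.MathematicalPhysics.StatisticalMechanics.BarlowStackingEnergy
import Summits.AtomisticToContinuum.Crystallization.Theorems.PricedLinkCensusStackingHingeSitewiseEvenAlignmentDomination

/-!
# Route PricedLinkCensus — the word column at all ranges (`StackingHinge`, line Sketch)
(stub `stub_wordColumn` of line Sketch, stmt-AtomisticToContinuum-14993)

For a Hägg word `s : ℤ → {±1}`, a layer `m` and SUMMABLE couplings `J` with `J₂ ≤ J₃ ≤ ⋯ ≤ 0`
(non-positive and non-decreasing from `k = 2` on):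

* (forward) the local Hägg energy `haggLocalEnergy J s m = ∑'_{k ≥ 2} J_k · 1[layers m, m+k aligned]`
  is bounded below by that of the alternating word (hcp), with deficit at least `J₃ − J₂` when the
  layers `m`, `m + 2` are not aligned;
* (backward) the same for `haggBackwardLocalEnergy J s m = ∑'_{k ≥ 2} J_k · 1[layers m−k, m aligned]`,
  with deficit when the layers `m − 2`, `m` are not aligned.

Proof.  The forward clauses are the limit `K → ∞` of the landed truncated lemma
`PricedHcpWindowsSitewise.stub_sitewiseEvenAlignmentDomination`: the partial sums over
`range (K + 1)` of the (summable, masked) series defining `haggLocalEnergy` are the truncated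
energies `haggLocalEnergyTrunc K` (`sum_range_succ_eq_trunc`, `tendsto_haggLocalEnergyTrunc`), and
limits preserve `≤` (`le_of_tendsto_of_tendsto`).  The backward clauses are the forward ones for the
reflected word `n ↦ s (m − 1 − n)` at layer `0`: the window of `s` on `[m − k, m)` is the window of
the reflected word on `[0, k)` (`haggWindow_reflect`), so the backward energy of `s` at `m` is the
forward energy of the reflected word at `0` (`haggBackwardLocalEnergy_eq_reflect`), while for the
alternating word both equal `∑'_{k ≥ 2 even} J_k` (`haggBackwardLocalEnergy_alternating`).

All `[folklore]`.
-/

namespace Summit.AtomisticToContinuum.Crystallization.Theorems.PricedHcpWindowsWordColumn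

open Literature.MathematicalPhysics.StatisticalMechanics Filter Topology
open Summit.AtomisticToContinuum.Crystallization.Theorems.PricedHcpWindowsSitewise

/-! ### The local energy as the limit of the truncated ones -/

/-- Partial sums of the masked series defining `haggLocalEnergy`: the sum over `range (K + 1)` is
the truncated energy of range `K` (the terms `k = 0, 1` vanish). [folklore] -/
theorem sum_range_succ_eq_trunc (J : ℕ → ℝ) (s : ℤ → ℤ) (m : ℤ) (K : ℕ) :
    ∑ k ∈ Finset.range (K + 1), (if 2 ≤ k ∧ HaggAligned s m k then J k else 0) =
      haggLocalEnergyTrunc K J s m := by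
  have hI : Finset.Icc 2 K = (Finset.range (K + 1)).filter (fun k => 2 ≤ k) := by
    ext k
    simp only [Finset.mem_Icc, Finset.mem_filter, Finset.mem_range]
    omega
  rw [haggLocalEnergyTrunc, hI, Finset.sum_filter]
  refine Finset.sum_congr rfl fun k _ => ?_
  by_cases hk : 2 ≤ k
  · simp [hk]
  · simp [hk]

/-- **The local energy is the limit of the truncated local energies** (summable couplings).
[folklore] -/
theorem tendsto_haggLocalEnergyTrunc {J : ℕ → ℝ} (hJ : Summable J) (s : ℤ → ℤ) (m : ℤ) :
    Tendsto (fun K => haggLocalEnergyTrunc K J s m) atTop (𝓝 (haggLocalEnergy J s m)) := by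
  have hf : Summable fun k => if 2 ≤ k ∧ HaggAligned s m k then J k else 0 :=
    summable_ite_of_summable hJ _
  have h := hf.tendsto_sum_tsum_nat.comp (tendsto_add_atTop_nat 1)
  unfold haggLocalEnergy
  refine h.congr fun K => ?_
  simp only [Function.comp_apply]
  exact sum_range_succ_eq_trunc J s m K

/-! ### Forward clauses -/

/-- **Word column, forward** (layers above): for a Hägg word `s`, summable couplings
`J₂ ≤ J₃ ≤ ⋯ ≤ 0`, the alternating word minimises `haggLocalEnergy J · m`, with deficit `J 3 − J 2`
when layers `m`, `m + 2` of `s` are not aligned.  Limit of the truncated domination. [folklore] -/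
theorem forward (J : ℕ → ℝ) {s : ℤ → ℤ} (m : ℤ) (hs : IsHaggSeq s) (hJ : Summable J)
    (hJ0 : ∀ k : ℕ, 2 ≤ k → J k ≤ 0) (hJm : ∀ k : ℕ, 2 ≤ k → J k ≤ J (k + 1)) :
    haggLocalEnergy J alternatingHagg m ≤ haggLocalEnergy J s m ∧
      (¬ HaggAligned s m 2 →
        haggLocalEnergy J alternatingHagg m + (J 3 - J 2) ≤ haggLocalEnergy J s m) := by
  have hA := tendsto_haggLocalEnergyTrunc hJ alternatingHagg m
  have hS := tendsto_haggLocalEnergyTrunc hJ s m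
  refine ⟨le_of_tendsto_of_tendsto' hA hS fun K =>
    (stub_sitewiseEvenAlignmentDomination K J s m hs hJ0 hJm).1, fun h2 => ?_⟩
  refine le_of_tendsto_of_tendsto (hA.add_const (J 3 - J 2)) hS ?_
  rw [EventuallyLE, eventually_atTop]
  exact ⟨3, fun K hK => (stub_sitewiseEvenAlignmentDomination K J s m hs hJ0 hJm).2 hK h2⟩

/-! ### Reflection: backward energies are forward energies of the reflected word -/

/-- **Reflection of windows**: the window of `s` on `[m − k, m)` is the window of the reflected
word `n ↦ s (m − 1 − n)` on `[0, k)` (both are `s (m−1) + ⋯ + s (m−k)`). [folklore] -/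
theorem haggWindow_reflect (s : ℤ → ℤ) (m : ℤ) (k : ℕ) :
    haggWindow s (m - k) k = haggWindow (fun n => s (m - 1 - n)) 0 k := by
  simp only [haggWindow, zero_add]
  rw [← Finset.sum_range_reflect (fun i : ℕ => s (m - 1 - (i : ℤ))) k]
  refine Finset.sum_congr rfl fun j hj => ?_
  have hj' := Finset.mem_range.mp hj
  congr 1
  omega

/-- Reflection of alignment: layers `m − k`, `m` of `s` are aligned iff layers `0`, `k` of the
reflected word are. [folklore] -/
theorem haggAligned_reflect (s : ℤ → ℤ) (m : ℤ) (k : ℕ) :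
    HaggAligned s (m - k) k ↔ HaggAligned (fun n => s (m - 1 - n)) 0 k := by
  show haggWindow s (m - k) k % 3 = 0 ↔ haggWindow (fun n => s (m - 1 - n)) 0 k % 3 = 0
  rw [haggWindow_reflect]

/-- **The backward local energy of `s` at `m` is the forward local energy of the reflected word
at `0`.** [folklore] -/
theorem haggBackwardLocalEnergy_eq_reflect (J : ℕ → ℝ) (s : ℤ → ℤ) (m : ℤ) :
    haggBackwardLocalEnergy J s m = haggLocalEnergy J (fun n => s (m - 1 - n)) 0 := by
  unfold haggBackwardLocalEnergy haggLocalEnergy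
  refine tsum_congr fun k => ?_
  simp only [haggAligned_reflect s m k]

/-- The reflected word of a Hägg word is a Hägg word. [folklore] -/
theorem isHaggSeq_reflect {s : ℤ → ℤ} (hs : IsHaggSeq s) (m : ℤ) :
    IsHaggSeq (fun n => s (m - 1 - n)) := fun n => hs (m - 1 - n)

/-- **Backward local energy of the alternating word**: `∑'_{k ≥ 2 even} J_k`, i.e. its forward
local energy (at any layer, here `0`). [folklore] -/
theorem haggBackwardLocalEnergy_alternating (J : ℕ → ℝ) (m : ℤ) :
    haggBackwardLocalEnergy J alternatingHagg m = haggLocalEnergy J alternatingHagg 0 := by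
  rw [haggLocalEnergy_alternating]
  unfold haggBackwardLocalEnergy
  refine tsum_congr fun k => ?_
  simp only [haggAligned_alternating_iff]

/-! ### Backward clauses -/

/-- **Word column, backward** (layers below): for a Hägg word `s`, summable couplings
`J₂ ≤ J₃ ≤ ⋯ ≤ 0`, the alternating word minimises `haggBackwardLocalEnergy J · m`, with deficit
`J 3 − J 2` when layers `m − 2`, `m` of `s` are not aligned.  The forward clauses for the reflected
word at layer `0`. [folklore] -/
theorem backward (J : ℕ → ℝ) {s : ℤ → ℤ} (m : ℤ) (hs : IsHaggSeq s) (hJ : Summable J)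
    (hJ0 : ∀ k : ℕ, 2 ≤ k → J k ≤ 0) (hJm : ∀ k : ℕ, 2 ≤ k → J k ≤ J (k + 1)) :
    haggBackwardLocalEnergy J alternatingHagg m ≤ haggBackwardLocalEnergy J s m ∧
      (¬ HaggAligned s (m - 2) 2 →
        haggBackwardLocalEnergy J alternatingHagg m + (J 3 - J 2) ≤
          haggBackwardLocalEnergy J s m) := by
  obtain ⟨h1, h2⟩ := forward J 0 (isHaggSeq_reflect hs m) hJ hJ0 hJm
  rw [haggBackwardLocalEnergy_alternating, haggBackwardLocalEnergy_eq_reflect]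
  refine ⟨h1, fun h => h2 ?_⟩
  have e := haggAligned_reflect s m 2
  rw [Nat.cast_ofNat] at e
  exact fun h' => h (e.mpr h')

/-! ### The stub -/

/-- **Word column at all ranges** (stub `stub_wordColumn` of line Sketch of `StackingHinge`).  For a
Hägg word `s`, a layer `m` and summable couplings with `J k ≤ 0`, `J k ≤ J (k + 1)` for `k ≥ 2`:
(i) `haggLocalEnergy J alternatingHagg m ≤ haggLocalEnergy J s m`, with deficit `J 3 − J 2` if
`¬ HaggAligned s m 2`; (ii) the same for `haggBackwardLocalEnergy`, with deficit if
`¬ HaggAligned s (m − 2) 2`.  Proof: `forward` (limit of the truncated domination) and `backward`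
(reflection). [folklore] -/
theorem stub_wordColumn : ∀ (J : ℕ → ℝ) (s : ℤ → ℤ) (m : ℤ), Literature.MathematicalPhysics.StatisticalMechanics.IsHaggSeq s → Summable J → (∀ k : ℕ, 2 ≤ k → J k ≤ 0) → (∀ k : ℕ, 2 ≤ k → J k ≤ J (k + 1)) → Literature.MathematicalPhysics.StatisticalMechanics.haggLocalEnergy J Literature.MathematicalPhysics.StatisticalMechanics.alternatingHagg m ≤ Literature.MathematicalPhysics.StatisticalMechanics.haggLocalEnergy J s m ∧ (¬ Literature.MathematicalPhysics.StatisticalMechanics.HaggAligned s m 2 → Literature.MathematicalPhysics.StatisticalMechanics.haggLocalEnergy J Literature.MathematicalPhysics.StatisticalMechanics.alternatingHagg m + (J 3 - J 2) ≤ Literature.MathematicalPhysics.StatisticalMechanics.haggLocalEnergy J s m) ∧ Literature.MathematicalPhysics.StatisticalMechanics.haggBackwardLocalEnergy J Literature.MathematicalPhysics.StatisticalMechanics.alternatingHagg m ≤ Literature.MathematicalPhysics.StatisticalMechanics.haggBackwardLocalEnergy J s m ∧ (¬ Literature.MathematicalPhysics.StatisticalMechanics.HaggAligned s (m - 2) 2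 → Literature.MathematicalPhysics.StatisticalMechanics.haggBackwardLocalEnergy J Literature.MathematicalPhysics.StatisticalMechanics.alternatingHagg m + (J 3 - J 2) ≤ Literature.MathematicalPhysics.StatisticalMechanics.haggBackwardLocalEnergy J s m) := by
  intro J s m hs hJ hJ0 hJm
  obtain ⟨h1, h2⟩ := forward J m hs hJ hJ0 hJm
  obtain ⟨h3, h4⟩ := backward J m hs hJ hJ0 hJm
  exact ⟨h1, h2, h3, h4⟩

end Summit.AtomisticToContinuum.Crystallization.Theorems.PricedHcpWindowsWordColumn
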